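import Literature.AlgebraicGeometry.ShiodaKatsura1979.SplitHypersurfaceBlowupDominates
import Literature.AlgebraicGeometry.Motives.GeneralNonsingularForms
import Literature.AlgebraicGeometry.Motives.UniversalHypersurfaceFibre
import HarnessLib

/-!
# The split form `f(x) + g(y)` and the Fermat suspension `f + u^m` of NONSINGULAR forms are
# nonsingular; the hypersurfaces `B_f`, `F_f`, `X_{f,g}` of Shioda–Katsura's inductive structure exist
# as smooth hypersurfaces

Topic `Literature/AlgebraicGeometry/ShiodaKatsura1979`; theorems only (no definition, no named fact).
Sequel to `SplitHypersurfaceBlowupDominates` (the forms `splitForm r s f g`, `suspension m r f` and the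
cited fact `shiodaKatsura1979_split_smoothBlowup_surjective`), written by the literature-typing seat
`littype-FH1-2` for planner P3's «SPLIT HYPERSURFACES» chapter so that its statements can quantify over
NONSINGULAR FORMS (`Motives.SmoothHypersurface.IsNonsingularForm`, the projective Jacobian criterion of
Hartshorne I Ex. 5.8) instead of over abstract reduced schemes cut out set-theoretically — the
set-theoretic predicate `IsHypersurfaceCutOutBy` does not see multiplicities (`V₊(h²) = V₊(h)`), so
"`S` smooth, cut out by a quartic `f`" does not make `S` a quartic surface (`f = h²`, `S` a quadric).

* §1 partial derivatives and values of `suspension m r f = f(x₀..x_r) + u^m` and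
  `splitForm r s f g = f(x) + g(y)`; every index of `Fin (r + s + 2)` is an `x`- or a `y`-index
  (`exists_eq_inX_or_eq_inY`).
* §2 **`isNonsingularForm_suspension`** — `f` nonsingular of degree `m ≥ 1` ⇒ `f + u^m` nonsingular
  (a common zero `(x, u)` of `f + u^m` and its partials has `m u^{m-1} = 0`, so `u = 0` or `m = 1`; then
  `f(x) = 0 = ∂ⱼf(x)`, so `x = 0`); **`isNonsingularForm_splitForm`** — `f`, `g` nonsingular of degree
  `m ≥ 1` ⇒ `f(x) + g(y)` nonsingular (the partials are `∂ᵢf(x)`, `∂ⱼg(y)`; by Euler `m·f(x) = Σ xᵢ∂ᵢf(x) = 0`,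
  so `x` is a common zero of `f` and its partials, `x = 0`, and likewise `y = 0`). Shioda–Katsura §1 /
  Remark 1.10 and Ran 1980 §4 use these hypersurfaces as "non-singular" without comment; the memo
  ROUTE-P3v20 §1 records the argument ("Sing ⊂ {∂f = 0 = ∂g} = ∅").
* §3 over `ℂ`: **`isSmoothHypersurface_hypersurface_of_isNonsingularForm`** (a nonsingular form of degree
  `d ≥ 1` in `n + 2 ≥ 3` variables cuts out the smooth hypersurface `SmoothHypersurface.hypersurface F` of
  dimension `n` and degree `d`, with `IsHypersurfaceCutOutBy`; the tree's Jacobian criterion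
  `isSmoothHypersurface_hypersurface` + `IsNonsingularForm.irreducible` over every overfield), and its
  instances for the base `B_f = V(f)`, the suspension `F_f = V(f + u^m)` and the split hypersurface
  `X_{f,g} = V(f(x) + g(y))`: these schemes EXIST, are smooth projective of dimensions `n`, `n + 1`,
  `n + n' + 2` and are cut out by `f`, `suspension m (n+1) f`, `splitForm (n+1) (n'+1) f g` — the
  witnesses `B_f, F_f, X` over which `shiodaKatsura1979_split_smoothBlowup_surjective` and
  `hodgeConjectureFor_split_of_pullbackAlgebraic` quantify.

## References

* [ShiodaKatsura1979] T. Shioda, T. Katsura, On Fermat varieties, Tôhoku Math. J. 31 (1979), §1 Remark 1.10.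
* [Hartshorne1977] R. Hartshorne, Algebraic Geometry, I Ex. 5.8 (projective Jacobian criterion),
  II Example 8.20.2, III Example 10.0.3.
-/

noncomputable section

open MvPolynomial
open Literature.AlgebraicGeometry.Motives Literature.AlgebraicGeometry.Motives.SmoothHypersurface

namespace Literature.AlgebraicGeometry.ShiodaKatsura1979

/-! ### §1 Partial derivatives and values of the suspension and of the split form -/

section Derivatives

variable {m r s : ℕ}

/-- `∂/∂xⱼ (f(x) + u^m) = (∂ⱼf)(x)`. [cite: Hartshorne1977, I Ex. 5.8] -/
theorem pderiv_castSucc_suspension (f : MvPolynomial (Fin (r + 1)) ℂ) (j : Fin (r + 1)) :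
    pderiv (Fin.castSucc j) (suspension m r f) = rename Fin.castSucc (pderiv j f) := by
  unfold suspension
  rw [map_add, pderiv_rename (Fin.castSucc_injective _), pderiv_pow,
    pderiv_X_of_ne (Fin.castSucc_lt_last j).ne', mul_zero, add_zero]

/-- `∂/∂u (f(x) + u^m) = m u^{m-1}`. [cite: Hartshorne1977, I Ex. 5.8] -/
theorem pderiv_last_suspension (f : MvPolynomial (Fin (r + 1)) ℂ) :
    pderiv (Fin.last (r + 1)) (suspension m r f) =
      (m : MvPolynomial (Fin (r + 2)) ℂ) * X (Fin.last (r + 1)) ^ (m - 1) := by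
  classical
  unfold suspension
  have hnot : Fin.last (r + 1) ∉ (rename Fin.castSucc f : MvPolynomial (Fin (r + 2)) ℂ).vars := by
    intro hmem
    obtain ⟨j, -, hj⟩ := Finset.mem_image.mp (vars_rename Fin.castSucc f hmem)
    exact (Fin.castSucc_lt_last j).ne hj
  rw [map_add, pderiv_eq_zero_of_notMem_vars hnot, zero_add, pderiv_pow, pderiv_X_self, mul_one]

/-- `(f + u^m)(x, u) = f(x) + u^m`. [cite: ShiodaKatsura1979, §1 Remark 1.10] -/
theorem eval_suspension (f : MvPolynomial (Fin (r + 1)) ℂ) (z : Fin (r + 2) → ℂ) :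
    eval z (suspension m r f) = eval (z ∘ Fin.castSucc) f + z (Fin.last (r + 1)) ^ m := by
  simp [suspension, eval_rename]

/-- `∂/∂xᵢ (f(x) + g(y)) = (∂ᵢf)(x)`. [cite: Hartshorne1977, I Ex. 5.8] -/
theorem pderiv_inX_splitForm (f : MvPolynomial (Fin (r + 1)) ℂ) (g : MvPolynomial (Fin (s + 1)) ℂ)
    (i : Fin (r + 1)) :
    pderiv (inX r s i) (splitForm r s f g) = rename (inX r s) (pderiv i f) := by
  classical
  unfold splitForm
  have hnot : inX r s i ∉ (rename (inY r s) g : MvPolynomial (Fin (r + s + 2)) ℂ).vars := by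
    intro hmem
    obtain ⟨j, -, hj⟩ := Finset.mem_image.mp (vars_rename (inY r s) g hmem)
    exact inX_ne_inY i j hj.symm
  rw [map_add, pderiv_rename (inX_injective r s), pderiv_eq_zero_of_notMem_vars hnot, add_zero]

/-- `∂/∂yⱼ (f(x) + g(y)) = (∂ⱼg)(y)`. [cite: Hartshorne1977, I Ex. 5.8] -/
theorem pderiv_inY_splitForm (f : MvPolynomial (Fin (r + 1)) ℂ) (g : MvPolynomial (Fin (s + 1)) ℂ)
    (j : Fin (s + 1)) :
    pderiv (inY r s j) (splitForm r s f g) = rename (inY r s) (pderiv j g) := by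
  classical
  unfold splitForm
  have hnot : inY r s j ∉ (rename (inX r s) f : MvPolynomial (Fin (r + s + 2)) ℂ).vars := by
    intro hmem
    obtain ⟨i, -, hi⟩ := Finset.mem_image.mp (vars_rename (inX r s) f hmem)
    exact inX_ne_inY i j hi
  rw [map_add, pderiv_rename (inY_injective r s), pderiv_eq_zero_of_notMem_vars hnot, zero_add]

/-- `(f(x) + g(y))(z) = f(z ∘ inX) + g(z ∘ inY)`. [cite: ShiodaKatsura1979, §1 Remark 1.10 (1.1)′] -/
theorem eval_splitForm (f : MvPolynomial (Fin (r + 1)) ℂ) (g : MvPolynomial (Fin (s + 1)) ℂ)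
    (z : Fin (r + s + 2) → ℂ) :
    eval z (splitForm r s f g) = eval (z ∘ inX r s) f + eval (z ∘ inY r s) g := by
  simp [splitForm, eval_rename]

variable (r s) in
/-- Every one of the `r + s + 2` coordinates is an `x`-coordinate or a `y`-coordinate.
[cite: ShiodaKatsura1979, §1 Remark 1.10 (1.1)′] -/
theorem exists_eq_inX_or_eq_inY (l : Fin (r + s + 2)) :
    (∃ i : Fin (r + 1), l = inX r s i) ∨ ∃ j : Fin (s + 1), l = inY r s j := by
  by_cases hl : l.val < r + 1
  · exact Or.inl ⟨⟨l.val, hl⟩, Fin.ext (by simp [inX])⟩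
  · exact Or.inr ⟨⟨l.val - (r + 1), by omega⟩, Fin.ext (by simp [inY]; omega)⟩

/-- A function on the coordinates vanishes if its `x`-part and its `y`-part vanish. [folklore] -/
private theorem eq_zero_of_comp_inX_inY {z : Fin (r + s + 2) → ℂ} (hx : z ∘ inX r s = 0) (hy : z ∘ inY r s = 0) :
    z = 0 := by
  funext l
  rcases exists_eq_inX_or_eq_inY r s l with ⟨i, rfl⟩ | ⟨j, rfl⟩
  · exact congrFun hx i
  · exact congrFun hy j

end Derivatives

/-! ### §2 Nonsingularity of `f + u^m` and of `f(x) + g(y)` -/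

section Nonsingular

variable {n n' m : ℕ}

/-- A common zero of all the partials of a form of degree `m ≥ 1` (over `ℂ`) is a zero of the form
(Euler: `m·f = Σ xᵢ ∂ᵢf`). [cite: Hartshorne1977, I Ex. 5.8] -/
theorem eval_eq_zero_of_forall_eval_pderiv_eq_zero {σ : Type*} [Fintype σ] (hm : 1 ≤ m)
    {f : MvPolynomial σ ℂ} (hf : f.IsHomogeneous m) {x : σ → ℂ} (hx : ∀ i, eval x (pderiv i f) = 0) :
    eval x f = 0 := by
  have h := congrArg (eval x) hf.sum_X_mul_pderiv
  rw [nsmul_eq_mul, map_mul, map_natCast, map_sum] at h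
  simp only [map_mul, eval_X, hx, mul_zero, Finset.sum_const_zero] at h
  have hm0 : (m : ℂ) ≠ 0 := Nat.cast_ne_zero.mpr (by omega)
  exact (mul_eq_zero.mp h.symm).resolve_left hm0

/-- **The Fermat suspension of a nonsingular form is nonsingular**: if `f(x₀, …, x_{n+1})` is a
nonsingular form of degree `m ≥ 1`, so is `f + u^m` in the `n + 3` variables `x₀, …, x_{n+1}, u`
(Shioda–Katsura's `Xʳₘ : f + x_{r+1}^m = 0`, `r = n + 1`, "non-singular"). Projective Jacobian criterion
over `ℂ`: at a common zero `(x, u) ≠ 0` of `f + u^m` and its partials, `m u^{m-1} = 0` forces `u = 0`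
(for `m = 1` the `u`-partial is `1`), then `f(x) = 0 = ∂ⱼf(x)` with `x ≠ 0`, contradicting the
nonsingularity of `f`. [cite: ShiodaKatsura1979, §1 Remark 1.10] [cite: Hartshorne1977, I Ex. 5.8] -/
theorem isNonsingularForm_suspension (hm : 1 ≤ m) {f : MvPolynomial (Fin (n + 2)) ℂ}
    (hJ : IsNonsingularForm ℂ f) : IsNonsingularForm ℂ (suspension m (n + 1) f) := by
  rw [isNonsingularForm_iff_forall_exists_eval_pderiv_ne_zero] at hJ ⊢
  intro z hz hFz
  by_contra h
  push Not at h
  -- the `u`-partial: `m u^{m-1} = 0`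
  have hu : z (Fin.last (n + 2)) = 0 := by
    have hl := h (Fin.last (n + 2))
    rw [pderiv_last_suspension, map_mul, map_natCast, map_pow, eval_X] at hl
    have hm0 : (m : ℂ) ≠ 0 := Nat.cast_ne_zero.mpr (by omega)
    have hpow : z (Fin.last (n + 2)) ^ (m - 1) = 0 := (mul_eq_zero.mp hl).resolve_left hm0
    rcases Nat.eq_zero_or_pos (m - 1) with h0 | hpos
    · rw [h0, pow_zero] at hpow
      exact absurd hpow one_ne_zero
    · exact (pow_eq_zero_iff hpos.ne').mp hpow
  -- the `x`-partials: `∂ⱼf(x) = 0`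
  have hx : ∀ j, eval (z ∘ Fin.castSucc) (pderiv j f) = 0 := fun j ↦ by
    have hj := h (Fin.castSucc j)
    rwa [pderiv_castSucc_suspension, eval_rename] at hj
  -- the value: `f(x) = 0`
  have hfx : eval (z ∘ Fin.castSucc) f = 0 := by
    rw [eval_suspension, hu, zero_pow (by omega), add_zero] at hFz
    exact hFz
  -- `x ≠ 0`
  have hxne : (z ∘ Fin.castSucc) ≠ 0 := by
    intro hx0
    apply hz
    funext i
    rcases Fin.eq_castSucc_or_eq_last i with ⟨j, rfl⟩ | rfl
    · exact congrFun hx0 j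
    · exact hu
  obtain ⟨j, hj⟩ := hJ _ hxne hfx
  exact hj (hx j)

/-- **The split form of two nonsingular forms is nonsingular**: if `f(x₀, …, x_{n+1})` and
`g(y₀, …, y_{n'+1})` are nonsingular forms of the same degree `m ≥ 1`, so is `f(x) + g(y)` in the
`n + n' + 4` variables (Shioda–Katsura's `X^{r+s}ₘ : f + g = 0`, `r = n + 1`, `s = n' + 1`; memo
ROUTE-P3v20 §1 "Sing ⊂ {∂f = 0 = ∂g} = ∅"). Projective Jacobian criterion over `ℂ`: the partials of
`f(x) + g(y)` are `∂ᵢf(x)` and `∂ⱼg(y)`; at a common zero, Euler's identity gives `f(x) = 0`, so `x` is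
a common zero of `f` and its partials, whence `x = 0`; likewise `y = 0`; so `(x, y) = 0`.
[cite: ShiodaKatsura1979, §1 Remark 1.10 (1.1)′] [cite: Hartshorne1977, I Ex. 5.8] -/
theorem isNonsingularForm_splitForm (hm : 1 ≤ m) {f : MvPolynomial (Fin (n + 2)) ℂ}
    {g : MvPolynomial (Fin (n' + 2)) ℂ} (hf : f.IsHomogeneous m) (hg : g.IsHomogeneous m)
    (hJf : IsNonsingularForm ℂ f) (hJg : IsNonsingularForm ℂ g) :
    IsNonsingularForm ℂ (splitForm (n + 1) (n' + 1) f g) := by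
  rw [isNonsingularForm_iff_forall_exists_eval_pderiv_ne_zero] at hJf hJg ⊢
  intro z hz _hFz
  by_contra h
  push Not at h
  have hx : ∀ i, eval (z ∘ inX (n + 1) (n' + 1)) (pderiv i f) = 0 := fun i ↦ by
    have hi := h (inX (n + 1) (n' + 1) i)
    rwa [pderiv_inX_splitForm, eval_rename] at hi
  have hy : ∀ j, eval (z ∘ inY (n + 1) (n' + 1)) (pderiv j g) = 0 := fun j ↦ by
    have hj := h (inY (n + 1) (n' + 1) j)
    rwa [pderiv_inY_splitForm, eval_rename] at hj
  have hx0 : z ∘ inX (n + 1) (n' + 1) = 0 := by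
    by_contra hne
    obtain ⟨i, hi⟩ := hJf _ hne (eval_eq_zero_of_forall_eval_pderiv_eq_zero hm hf hx)
    exact hi (hx i)
  have hy0 : z ∘ inY (n + 1) (n' + 1) = 0 := by
    by_contra hne
    obtain ⟨j, hj⟩ := hJg _ hne (eval_eq_zero_of_forall_eval_pderiv_eq_zero hm hg hy)
    exact hj (hy j)
  exact hz (eq_zero_of_comp_inX_inY hx0 hy0)

end Nonsingular

/-! ### §3 Over `ℂ`: the hypersurfaces `B_f`, `F_f`, `X_{f,g}` exist as smooth hypersurfaces -/

section Hypersurfaces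

variable {n n' m d : ℕ}

/-- **A nonsingular form of degree `d ≥ 1` in `n + 2 ≥ 3` variables over `ℂ` cuts out a smooth
hypersurface of dimension `n` and degree `d`** — the reduced subscheme
`SmoothHypersurface.hypersurface F = V₊(F) ⊂ ℙⁿ⁺¹` (the tree's Jacobian criterion
`isSmoothHypersurface_hypersurface`, with the irreducibility of nonsingular forms in `≥ 3` variables
over every overfield, `IsNonsingularForm.irreducible`). [cite: Hartshorne1977, I Ex. 5.8, II Example 8.20.2 and III Example 10.0.3] -/
theorem isSmoothHypersurface_hypersurface_of_isNonsingularForm (hn : 1 ≤ n) (hd : 1 ≤ d)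
    {F : MvPolynomial (Fin (n + 2)) ℂ} (hF : F.IsHomogeneous d) (hJ : IsNonsingularForm ℂ F) :
    IsSmoothHypersurface n d (hypersurface F) :=
  isSmoothHypersurface_hypersurface F hF hd hJ
    (fun K _ _ ↦ (hJ.map (algebraMap ℂ K)).irreducible hn hd (hF.map _))

/-- The same, unpacked: `V₊(F)` is smooth projective of dimension `n` and is cut out by `F`.
[cite: Hartshorne1977, I Ex. 5.8 and III Example 10.0.3] -/
theorem isSmoothProjective_hypersurface_of_isNonsingularForm (hn : 1 ≤ n) (hd : 1 ≤ d)
    {F : MvPolynomial (Fin (n + 2)) ℂ} (hF : F.IsHomogeneous d) (hJ : IsNonsingularForm ℂ F) :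
    IsSmoothProjective n (hypersurface F) ∧ IsHypersurfaceCutOutBy (n + 1) F (hypersurface F) :=
  ⟨(isSmoothHypersurface_hypersurface_of_isNonsingularForm hn hd hF hJ).1,
    isHypersurfaceCutOutBy_hypersurface F hF hJ hd⟩

/-- **The Fermat suspension `F_f = V(f + u^m) ⊂ ℙ^{n+2}` of a nonsingular form `f(x₀, …, x_{n+1})` of
degree `m ≥ 1` exists as a smooth hypersurface of dimension `n + 1` and degree `m`**, cut out by
`suspension m (n+1) f`. [cite: ShiodaKatsura1979, §1 Remark 1.10] [cite: Hartshorne1977, I Ex. 5.8] -/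
theorem isSmoothHypersurface_hypersurface_suspension (hm : 1 ≤ m) {f : MvPolynomial (Fin (n + 2)) ℂ}
    (hf : f.IsHomogeneous m) (hJ : IsNonsingularForm ℂ f) :
    IsSmoothHypersurface (n + 1) m (hypersurface (suspension m (n + 1) f)) ∧
      IsHypersurfaceCutOutBy (n + 2) (suspension m (n + 1) f) (hypersurface (suspension m (n + 1) f)) :=
  ⟨isSmoothHypersurface_hypersurface_of_isNonsingularForm (by omega) hm (isHomogeneous_suspension hf)
      (isNonsingularForm_suspension hm hJ),
    isHypersurfaceCutOutBy_hypersurface _ (isHomogeneous_suspension hf)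
      (isNonsingularForm_suspension hm hJ) hm⟩

/-- **The split hypersurface `X_{f,g} = V(f(x) + g(y)) ⊂ ℙ^{n+n'+3}` of two nonsingular forms of degree
`m ≥ 1` exists as a smooth hypersurface of dimension `n + n' + 2` and degree `m`**, cut out by
`splitForm (n+1) (n'+1) f g`. [cite: ShiodaKatsura1979, §1 Remark 1.10 (1.1)′] [cite: Hartshorne1977, I Ex. 5.8] -/
theorem isSmoothHypersurface_hypersurface_splitForm (hm : 1 ≤ m) {f : MvPolynomial (Fin (n + 2)) ℂ}
    {g : MvPolynomial (Fin (n' + 2)) ℂ} (hf : f.IsHomogeneous m) (hg : g.IsHomogeneous m)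
    (hJf : IsNonsingularForm ℂ f) (hJg : IsNonsingularForm ℂ g) :
    IsSmoothHypersurface (n + 1 + (n' + 1)) m (hypersurface (splitForm (n + 1) (n' + 1) f g)) ∧
      IsHypersurfaceCutOutBy (n + 1 + (n' + 1) + 1) (splitForm (n + 1) (n' + 1) f g)
        (hypersurface (splitForm (n + 1) (n' + 1) f g)) :=
  ⟨isSmoothHypersurface_hypersurface_of_isNonsingularForm (by omega) hm (isHomogeneous_splitForm hf hg)
      (isNonsingularForm_splitForm hm hf hg hJf hJg),
    isHypersurfaceCutOutBy_hypersurface _ (isHomogeneous_splitForm hf hg)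
      (isNonsingularForm_splitForm hm hf hg hJf hJg) hm⟩

end Hypersurfaces

end Literature.AlgebraicGeometry.ShiodaKatsura1979

end
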